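import Summits.BirchSwinnertonDyer.BirchSwinnertonDyer.Theorems.SylvesterTwoHeegnerIndexCMDataRationality
import Summits.BirchSwinnertonDyer.Rank1Residual.X11b.KolyvaginTraceRelation
import Literature.NumberTheory.EllipticCurves.HuShuYin2019.SylvesterCMTowerTraceRelation
import Literature.NumberTheory.EllipticCurves.HeegnerPointsKolyvaginPrimaryEulerProofs
import Literature.NumberTheory.EllipticCurves.JZeroKolyvaginPrimes
import HarnessLib

/-!
# DATA LAYER (R-b) of leaf (L1), crux `UpperOffV0HSYPlus` (stmt-BirchSwinnertonDyer-19804): the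
# FINITE-LEVEL Kolyvagin property of `D_ℓ y_ℓ` at ONE Kolyvagin prime of Hu–Shu–Yin's CM tower —
# `[D_ℓ y_ℓ] ∈ (E(K[9pℓ]) / 2^M)^{Gal(K[9pℓ]/K[9p])}` (Gross 1991 Prop. 3.6 at HSY's frame, `p = 2`)

Skeleton of record VARIANT M (`Cruxes/UpperOffV0HSYPlus/Lines/coupled_variantM.lean` 406ca288e244d392),
line card v24: residual (R) = the class terms of leaf (L1) via the recipe R0
`HuShuYin2019.exists_cmFrame_kolyvaginClass`, whose Euler-system input is `hP : ∀ h ∈ N', ∃ a ∈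
E_9(K̄)^N, 2^M • a = h • P − P` for the derived CM point `P`.  By k-ty1's bridge
`exists_fixedPoints_zsmul_eq_of_finite_level` (`GeomPointsEmbeddingDescent`, p622063) `hP` follows from
its FINITE-LEVEL form `hfin : ∀ σ ∈ Aut(L/K), σ|_S = id → ∃ a₀ ∈ E(L), 2^M a₀ = σ P₀ − P₀`.  This file
PROVES `hfin` for `L = K[9pℓ]`, `S = K[9pℓ] ∩ K[9p]`, `P₀ = D_ℓ y_ℓ` (one Kolyvagin prime `ℓ`; the classes
`c_A(ℓ)` of (L1)), from the tree's PROVED (ES1) and Gross's §3 algebra: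

* `sum_pointGalHom_eq_lFunction_smul_sylvester_prime` — (ES1) at the bottom of HSY's tower written at
  the level `9·p·ℓ` (no `n·ℓ` bookkeeping): `Σ_{g ∈ G_ℓ} g • y = a_ℓ • y₀` in `E(K[9pℓ])` for `y` over
  `φ(τ_{Q^{(ℓ)}})` and `y₀` over `φ(τ_{Q_p})` (`HeegnerTraceOrders.sum_pointGalHom_eq_lFunction_smul_of_fix`
  + `levelTransport_self_sylvesterPoint_one_of_fix`, exactly as p627619 at `n = 1`);
* `sum_range_pointGalHom_pow_eq_lFunction_smul_sylvester_prime` — the same along the powers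
  `σ_ℓ^k`, `k ≤ ℓ`, of a generator `σ_ℓ` of `G_ℓ = ringClassGalOver ι (9pℓ) (9p)` (`orderOf σ_ℓ = ℓ + 1`,
  x11b3's `sum_range_pow_eq_sum_image` / `mem_image_pow_iff_mem_ringClassGalOver`), i.e. `Tr_ℓ y = a_ℓ y₀`
  in the group-ring shape of `KolyvaginEuler`;
* `exists_zsmul_eq_pointGalHom_derivOp_sub` — **Gross 3.6 at HSY's frame**: if `2^M ∣ ℓ + 1` and
  `2^M ∣ a_ℓ` (`a_ℓ = W.LFunction ℓ`; `= 0` for every minimal model of `E_9`, `j = 0`, by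
  `JZero.lFunction_eq_zero_of_j_eq_zero_of_mod_three_eq_two`), then for every `g ∈ G_ℓ`,
  `g (D_ℓ y) − D_ℓ y ∈ 2^M E(K[9pℓ])`, `D_ℓ = Σ_{i ≤ ℓ} i σ_ℓ^i` the tree's
  `KolyvaginOperator.derivOp (pointGalHom W K[9pℓ]) σ_ℓ ℓ` (via `KolyvaginEuler.smul_grAct_derivProd_sub_mem`
  on the cyclic group `⟨σ_ℓ⟩`);
* `exists_zsmul_eq_map_derivOp_sub_of_fix` — the `hfin` SHAPE consumed by
  `exists_fixedPoints_zsmul_eq_of_finite_level`: for every `τ ∈ Aut(K[9pℓ]/K)` fixing the elements of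
  `K[9pℓ]` lying in `K[9p]`, `∃ a₀, 2^M • a₀ = τ(D_ℓ y) − D_ℓ y`;
* `exists_zsmul_eq_map_derivOp_sub_of_fix_of_j_eq_zero` — with `2^M ∣ a_ℓ` DISCHARGED for `W` a global
  minimal model with `j = 0` and `ℓ ∤ Δ_min(W)` (so for E₉'s `⟨0,0,1,0,−1⟩`, Δ_min = −243, k-ty1 #16).

HONEST FRAMING: theorems only (no definition, no named fact, no instance, no notation); an ASSEMBLY of
PROVED tree theorems ((ES1) p626852/p627619, rationality p656863, x11b3's generator/order lemmas, the
`KolyvaginEuler` algebra); the data `y`, `y₀`, `σ_ℓ` are universally quantified under their defining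
equations (they EXIST: `exists_map_eq_phi_sylvesterTau…`, `RingClassGalOverCyclic.exists_zpowers_eq_ringClassGalOver_mul`);
nothing about Selmer groups, `Ш`, the FLIP, the height display or BSD is asserted; no stub of VARIANT M is
closed; `--supports stmt-BirchSwinnertonDyer-19804 --as helper`.

## References
* B. H. Gross, *Kolyvagin's work on modular elliptic curves*, LMS LNS 153 (1991), §3 (3.3), (3.5), Prop. 3.6,
  Prop. 3.7 (1). [GrossLMS1991] · W. G. McCallum, same volume, §4 (4). [McCallumLMS1991] · Y. Hu, J. Shu,
  H. Yin, Trans. AMS 372 (2019), arXiv 1708.05266 §4.1 (p. 10 L92). [HuShuYin2019] · J. Nekovář, LMS LNS 320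
  (2007), Prop. (4.13) (i). [Nekovar2007]
## Mathlib / tree search
Tree: `HeegnerTraceOrders.sum_pointGalHom_eq_lFunction_smul_of_fix`; `levelTransport_self_sylvesterPoint_one_of_fix`,
`sylvesterForm_mem_heegnerForms`, `isCoprime_C_of_forall_prime_mod_three_eq_two`; `isHeckeNeighbour_heegnerTau_conductorMul`;
x11b3 `RingClassTower.orderOf_eq_succ_of_zpowers_eq_ringClassGalOver`, `sum_range_pow_eq_sum_image`,
`mem_image_pow_iff_mem_ringClassGalOver`; `KolyvaginEuler.smul_grAct_derivProd_sub_mem`, `grAct_traceElt_mem_of_eq_smul`,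
`smul_sub_mem_of_mem_closure`; `KolyvaginOperator.derivOp`; `JZero.lFunction_eq_zero_of_j_eq_zero_of_mod_three_eq_two`.
`lean search 'derivOp.*sylvester'` → nothing before this file. presearch: Gross 3.6 at HSY's frame →
[corpus:book:editornd-l-functions-arithmetic PDF p. 217] (the printed algebra = the tree's `KolyvaginEuler`); galaxy n/a.
-/

set_option linter.dupNamespace false -- Summits modules are `Summit.<Summit>.<Problem>…` by design

noncomputable section

open scoped Classical

namespace Summit.BirchSwinnertonDyer.BirchSwinnertonDyer.Theorems.SylvesterTwoCMData

open Complex UpperHalfPlane NumberField WeierstrassCurve Finset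
open Literature.NumberTheory.EllipticCurves Literature.NumberTheory.EllipticCurves.ModularForms
  Literature.NumberTheory.EllipticCurves.HuShuYin2019
  Literature.NumberTheory.QuadraticFields.BinaryQuadraticForm
  Literature.NumberTheory.QuadraticFields.Quadratic
  Literature.NumberTheory.EllipticCurves.KolyvaginEuler
  Summit.BirchSwinnertonDyer.Rank1Residual.X11b.RingClassTower

variable {K : Type} [Field K] [NumberField K]

/-! ### (ES1) at the bottom of the tower, written at the level `9·p·ℓ` -/

/-- **(ES1) `Σ_{g ∈ G_ℓ} g • y_ℓ = a_ℓ • y₁` in `E(K[9pℓ])`** for Hu–Shu–Yin's CM points — `y_ℓ` over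
`φ(τ_{(ℓ²A, ℓB, C)})` (conductor `9pℓ`), `y₁` over `φ(τ_{(A, B, C)})` = HSY's `P₀ = f(P₁)` (conductor `9p`)
pushed into `E(K[9pℓ])`, `G_ℓ = Gal(K[9pℓ]/K[9p])`, `a_ℓ = W.LFunction ℓ` — for `K` imaginary quadratic
with `d_K = −3`, any `W/ℚ` with `Dt` at level `243`, `p ≡ 1 (mod 3)`, `ℓ ≡ 2 (mod 3)` a prime with
`ℓ ∤ p` and `(ℓ)` prime in `𝓞 K`.  Gross 1991 Prop. 3.7 (1) / Nekovář (4.13) (i) at HSY's frame; the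
`n = 1` case of p627619 written at the level `9 * p * ℓ`.
[cite: GrossLMS1991, Prop. 3.7 (1) (p. 240)] [cite: Nekovar2007, Prop. (4.13) (i) (p. 0573)]
[cite: HuShuYin2019, §4.1 (p. 10 L92)] -/
theorem sum_pointGalHom_eq_lFunction_smul_sylvester_prime (hK : IsImaginaryQuadratic K)
    (hdK : NumberField.discr K = -3) (ι : K →+* ℂ) {W : WeierstrassCurve ℚ}
    (Dt : ModularParametrizationData W 243) {p ℓ : ℕ} (hp : p % 3 = 1) (hℓ : ℓ.Prime)
    (hℓ3 : ℓ % 3 = 2) (hℓp : ¬ ℓ ∣ p) (hinert : (Ideal.span {(ℓ : 𝓞 K)}).IsPrime)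
    {G : Finset (ringClassField K ι (9 * p * ℓ) ≃ₐ[ℚ] ringClassField K ι (9 * p * ℓ))}
    (hG : ∀ g, g ∈ G ↔ g ∈ ringClassGalOver ι (9 * p * ℓ) (9 * p))
    {y y₀ : (W.baseChange (ringClassField K ι (9 * p * ℓ))).toAffine.Point}
    (hy : Affine.Point.map (W' := W) (ringClassField K ι (9 * p * ℓ)).subtype.toRatAlgHom y =
      Dt.φ (heegnerTau ((ℓ : ℤ) ^ 2 * (81 * ((p : ℤ) ^ 2 + 4 * p + 16)),
        (ℓ : ℤ) * (-(9 * (4 * (p : ℤ) ^ 2 + 17 * p + 72))), 4 * (p : ℤ) ^ 2 + 18 * p + 81)))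
    (hy₀ : Affine.Point.map (W' := W) (ringClassField K ι (9 * p * ℓ)).subtype.toRatAlgHom y₀ =
      Dt.φ (heegnerTau (81 * ((p : ℤ) ^ 2 + 4 * p + 16), -(9 * (4 * (p : ℤ) ^ 2 + 17 * p + 72)),
        4 * (p : ℤ) ^ 2 + 18 * p + 81))) :
    ∑ g ∈ G, pointGalHom W (ringClassField K ι (9 * p * ℓ)) g y = W.LFunction ℓ • y₀ := by
  haveI : NeZero (243 : ℕ) := ⟨by norm_num⟩
  have hp0 : p ≠ 0 := by rintro rfl; simp at hp
  have hℓ3' : ℓ ≠ 3 := by rintro rfl; simp at hℓ3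
  have hℓN : ¬ ℓ ∣ 243 := by
    intro h
    have h' : ℓ ∣ 3 ^ 5 := by norm_num; exact h
    exact hℓ3' ((Nat.prime_dvd_prime_iff_eq hℓ Nat.prime_three).mp (hℓ.dvd_of_dvd_pow h'))
  have hℓ9 : ¬ ℓ ∣ 9 := by
    intro h
    have h' : ℓ ∣ 3 ^ 2 := by norm_num; exact h
    exact hℓ3' ((Nat.prime_dvd_prime_iff_eq hℓ Nat.prime_three).mp (hℓ.dvd_of_dvd_pow h'))
  have hℓf : ¬ ℓ ∣ 9 * p := by
    intro h
    rcases (Nat.Prime.dvd_mul hℓ).mp h with h9 | hp'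
    · exact hℓ9 h9
    · exact hℓp hp'
  have hf : 9 * p ≠ 0 := mul_ne_zero (by norm_num) hp0
  have hunits : 2 ≤ 9 * p ∨ NumberField.discr K < -4 := by left; omega
  have hlev : ℓ * (9 * p) = 9 * p * ℓ := by ring
  -- the form of conductor `9p` (HSY's `Q_p`) and the one of conductor `9pℓ`
  have hQ : ((81 * ((p : ℤ) ^ 2 + 4 * p + 16)), (-(9 * (4 * (p : ℤ) ^ 2 + 17 * p + 72))),
      4 * (p : ℤ) ^ 2 + 18 * p + 81) ∈ heegnerForms 243 (((9 * p : ℕ) : ℤ) ^ 2 * (-3)) := by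
    have h := sylvesterForm_mem_heegnerForms (n := 1) hp one_ne_zero isCoprime_one_left
    simp only [Nat.cast_one, one_pow, one_mul, mul_one] at h
    exact h
  have hℓC : IsCoprime (ℓ : ℤ) (4 * (p : ℤ) ^ 2 + 18 * p + 81) :=
    isCoprime_C_of_forall_prime_mod_three_eq_two (p := p) (n := ℓ) hℓ.ne_zero fun q hq ↦ by
      rw [hℓ.primeFactors, Finset.mem_singleton] at hq
      rw [hq]; exact hℓ3
  have hQ' := sylvesterForm_mem_heegnerForms (n := ℓ) hp hℓ.ne_zero hℓC
  have hD : ((81 * ((p : ℤ) ^ 2 + 4 * p + 16)), (-(9 * (4 * (p : ℤ) ^ 2 + 17 * p + 72))),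
      4 * (p : ℤ) ^ 2 + 18 * p + 81).2.1 ^ 2 -
      4 * ((81 * ((p : ℤ) ^ 2 + 4 * p + 16)), (-(9 * (4 * (p : ℤ) ^ 2 + 17 * p + 72))),
        4 * (p : ℤ) ^ 2 + 18 * p + 81).1 * ((81 * ((p : ℤ) ^ 2 + 4 * p + 16)),
          (-(9 * (4 * (p : ℤ) ^ 2 + 17 * p + 72))), 4 * (p : ℤ) ^ 2 + 18 * p + 81).2.2 < 0 := by
    rw [hQ.1]
    have : (0 : ℤ) < ((9 * p : ℕ) : ℤ) ^ 2 := by positivity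
    linarith
  have hx' : IsHeckeNeighbour 243 ℓ
      (heegnerTau (81 * ((p : ℤ) ^ 2 + 4 * p + 16), -(9 * (4 * (p : ℤ) ^ 2 + 17 * p + 72)),
        4 * (p : ℤ) ^ 2 + 18 * p + 81))
      (heegnerTau ((ℓ : ℤ) ^ 2 * (81 * ((p : ℤ) ^ 2 + 4 * p + 16)),
        (ℓ : ℤ) * (-(9 * (4 * (p : ℤ) ^ 2 + 17 * p + 72))), 4 * (p : ℤ) ^ 2 + 18 * p + 81)) :=
    isHeckeNeighbour_heegnerTau_conductorMul hQ.2.1 hD hℓ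
  have hQ'disc : discr (((ℓ : ℤ) ^ 2 * (81 * ((p : ℤ) ^ 2 + 4 * p + 16))),
      ((ℓ : ℤ) * (-(9 * (4 * (p : ℤ) ^ 2 + 17 * p + 72)))), 4 * (p : ℤ) ^ 2 + 18 * p + 81) =
      ((9 * p * ℓ : ℕ) : ℤ) ^ 2 * NumberField.discr K := by
    rw [hdK]; exact hQ'.1
  exact HeegnerTraceOrders.sum_pointGalHom_eq_lFunction_smul_of_fix hK ι Dt hℓ hinert hℓN hℓf hf
    hunits hlev (fun σ hσ ↦ levelTransport_self_sylvesterPoint_one_of_fix hK hdK ι hp hσ) hQ'.2.1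
    ((isPrimitive_iff_binQF _).mpr ((BinQF.isPrimitive_iff _).mpr hQ'.2.2.2)) hQ'disc hx' hG hy hy₀

/-- **`orderOf σ_ℓ = ℓ + 1`** for a generator `σ_ℓ` of `G_ℓ = Gal(K[9pℓ]/K[9p])` (`ℓ` inert, `ℓ ∤ 9p`,
`p ≠ 0`): x11b3's `orderOf_eq_succ_of_zpowers_eq_ringClassGalOver` at HSY's levels.
[cite: GrossLMS1991, §3 (PDF p. 217 l. 1–3: G_ℓ cyclic of order ℓ+1)] -/
theorem orderOf_eq_succ_sylvester_prime (hK : IsImaginaryQuadratic K) (ι : K →+* ℂ) {p ℓ : ℕ}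
    (hp0 : p ≠ 0) (hℓ : ℓ.Prime) (hℓ9p : ¬ ℓ ∣ 9 * p) (hinert : (Ideal.span {(ℓ : 𝓞 K)}).IsPrime)
    {σ : ringClassField K ι (9 * p * ℓ) ≃ₐ[ℚ] ringClassField K ι (9 * p * ℓ)}
    (hσ : Subgroup.zpowers σ = ringClassGalOver ι (9 * p * ℓ) (9 * p)) : orderOf σ = ℓ + 1 := by
  have hdiv : 9 * p * ℓ / ℓ = 9 * p := Nat.mul_div_cancel _ hℓ.pos
  have hn0 : 9 * p * ℓ ≠ 0 := mul_ne_zero (mul_ne_zero (by norm_num) hp0) hℓ.ne_zero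
  exact orderOf_eq_succ_of_zpowers_eq_ringClassGalOver hK ι hℓ hinert (dvd_mul_left ℓ (9 * p))
    (by rw [hdiv]; exact hℓ9p) hn0 (by rw [hdiv]; left; omega) (by rw [hdiv]; exact hσ)

/-- **(ES1) along the powers of a generator: `Σ_{k ≤ ℓ} σ_ℓ^k • y_ℓ = a_ℓ • y₁` in `E(K[9pℓ])`** —
the trace `Tr_ℓ y_ℓ` of Gross's §3 in the shape of `KolyvaginEuler.traceElt`, for `σ_ℓ` with
`⟨σ_ℓ⟩ = G_ℓ = ringClassGalOver ι (9pℓ) (9p)` (the powers `σ_ℓ^k`, `k ≤ ℓ`, enumerate `G_ℓ` without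
repetition: `orderOf σ_ℓ = ℓ + 1`). [cite: GrossLMS1991, §3 Prop. 3.7 (1) (p. 240)]
[cite: Nekovar2007, Prop. (4.13) (i) (p. 0573)] -/
theorem sum_range_pointGalHom_pow_eq_lFunction_smul_sylvester_prime (hK : IsImaginaryQuadratic K)
    (hdK : NumberField.discr K = -3) (ι : K →+* ℂ) {W : WeierstrassCurve ℚ}
    (Dt : ModularParametrizationData W 243) {p ℓ : ℕ} (hp : p % 3 = 1) (hℓ : ℓ.Prime)
    (hℓ3 : ℓ % 3 = 2) (hℓp : ¬ ℓ ∣ p) (hinert : (Ideal.span {(ℓ : 𝓞 K)}).IsPrime)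
    {σ : ringClassField K ι (9 * p * ℓ) ≃ₐ[ℚ] ringClassField K ι (9 * p * ℓ)}
    (hσ : Subgroup.zpowers σ = ringClassGalOver ι (9 * p * ℓ) (9 * p))
    {y y₀ : (W.baseChange (ringClassField K ι (9 * p * ℓ))).toAffine.Point}
    (hy : Affine.Point.map (W' := W) (ringClassField K ι (9 * p * ℓ)).subtype.toRatAlgHom y =
      Dt.φ (heegnerTau ((ℓ : ℤ) ^ 2 * (81 * ((p : ℤ) ^ 2 + 4 * p + 16)),
        (ℓ : ℤ) * (-(9 * (4 * (p : ℤ) ^ 2 + 17 * p + 72))), 4 * (p : ℤ) ^ 2 + 18 * p + 81)))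
    (hy₀ : Affine.Point.map (W' := W) (ringClassField K ι (9 * p * ℓ)).subtype.toRatAlgHom y₀ =
      Dt.φ (heegnerTau (81 * ((p : ℤ) ^ 2 + 4 * p + 16), -(9 * (4 * (p : ℤ) ^ 2 + 17 * p + 72)),
        4 * (p : ℤ) ^ 2 + 18 * p + 81))) :
    ∑ k ∈ Finset.range (ℓ + 1), pointGalHom W (ringClassField K ι (9 * p * ℓ)) (σ ^ k) y =
      W.LFunction ℓ • y₀ := by
  have hp0 : p ≠ 0 := by rintro rfl; simp at hp
  have hℓ3' : ℓ ≠ 3 := by rintro rfl; simp at hℓ3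
  have hℓ9 : ¬ ℓ ∣ 9 := by
    intro h
    have h' : ℓ ∣ 3 ^ 2 := by norm_num; exact h
    exact hℓ3' ((Nat.prime_dvd_prime_iff_eq hℓ Nat.prime_three).mp (hℓ.dvd_of_dvd_pow h'))
  have hℓ9p : ¬ ℓ ∣ 9 * p := by
    intro h
    rcases (Nat.Prime.dvd_mul hℓ).mp h with h9 | hp'
    · exact hℓ9 h9
    · exact hℓp hp'
  have hf : 9 * p ≠ 0 := mul_ne_zero (by norm_num) hp0
  have hunits : 2 ≤ 9 * p ∨ NumberField.discr K < -4 := by left; omega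
  have hlev : ℓ * (9 * p) = 9 * p * ℓ := by ring
  have hdiv : 9 * p * ℓ / ℓ = 9 * p := Nat.mul_div_cancel _ hℓ.pos
  have hσ' : Subgroup.zpowers σ = ringClassGalOver ι (9 * p * ℓ) (9 * p * ℓ / ℓ) := by
    rw [hdiv]; exact hσ
  rw [sum_range_pow_eq_sum_image hK ι hlev hℓ hinert hℓ9p hf hunits hσ'
    (fun g ↦ pointGalHom W (ringClassField K ι (9 * p * ℓ)) g y)]
  exact sum_pointGalHom_eq_lFunction_smul_sylvester_prime hK hdK ι Dt hp hℓ hℓ3 hℓp hinert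
    (fun g ↦ mem_image_pow_iff_mem_ringClassGalOver hK ι hlev hℓ hinert hℓ9p hf hunits hσ' g) hy hy₀

/-! ### Gross's Prop. 3.6 at HSY's frame: `[D_ℓ y_ℓ]` is fixed by `G_ℓ` modulo `2^M` -/

/-- **`g (D_ℓ y_ℓ) − D_ℓ y_ℓ ∈ 2^M · E(K[9pℓ])` for every `g ∈ G_ℓ`** (Gross 1991 Prop. 3.6 / McCallum
(4) at HSY's frame and `p = 2`): with `σ_ℓ` a generator of `G_ℓ = Gal(K[9pℓ]/K[9p])`,
`D_ℓ = Σ_{i ≤ ℓ} i σ_ℓ^i` (`KolyvaginOperator.derivOp (pointGalHom W K[9pℓ]) σ_ℓ ℓ`), `2^M ∣ ℓ + 1` and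
`2^M ∣ a_ℓ = W.LFunction ℓ` (Gross (3.3); for `E_9`, `a_ℓ = 0`): by (3.5)
`(σ_ℓ − 1) D_ℓ y = (ℓ+1) y − Tr_ℓ y = (ℓ+1) y − a_ℓ y₁ ∈ 2^M E(K[9pℓ])`, and `G_ℓ = ⟨σ_ℓ⟩`.
[cite: GrossLMS1991, §3 (3.3), (3.5), Prop. 3.6 (PDF p. 217)] [cite: McCallumLMS1991, §4 (4) (p. 300)] -/
theorem exists_zsmul_eq_pointGalHom_derivOp_sub (hK : IsImaginaryQuadratic K)
    (hdK : NumberField.discr K = -3) (ι : K →+* ℂ) {W : WeierstrassCurve ℚ}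
    (Dt : ModularParametrizationData W 243) {p ℓ : ℕ} (hp : p % 3 = 1) (hℓ : ℓ.Prime)
    (hℓ3 : ℓ % 3 = 2) (hℓp : ¬ ℓ ∣ p) (hinert : (Ideal.span {(ℓ : 𝓞 K)}).IsPrime) {M : ℕ}
    (hMℓ : 2 ^ M ∣ ℓ + 1) (hMa : ((2 ^ M : ℕ) : ℤ) ∣ W.LFunction ℓ)
    {σ : ringClassField K ι (9 * p * ℓ) ≃ₐ[ℚ] ringClassField K ι (9 * p * ℓ)}
    (hσ : Subgroup.zpowers σ = ringClassGalOver ι (9 * p * ℓ) (9 * p))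
    {y y₀ : (W.baseChange (ringClassField K ι (9 * p * ℓ))).toAffine.Point}
    (hy : Affine.Point.map (W' := W) (ringClassField K ι (9 * p * ℓ)).subtype.toRatAlgHom y =
      Dt.φ (heegnerTau ((ℓ : ℤ) ^ 2 * (81 * ((p : ℤ) ^ 2 + 4 * p + 16)),
        (ℓ : ℤ) * (-(9 * (4 * (p : ℤ) ^ 2 + 17 * p + 72))), 4 * (p : ℤ) ^ 2 + 18 * p + 81)))
    (hy₀ : Affine.Point.map (W' := W) (ringClassField K ι (9 * p * ℓ)).subtype.toRatAlgHom y₀ =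
      Dt.φ (heegnerTau (81 * ((p : ℤ) ^ 2 + 4 * p + 16), -(9 * (4 * (p : ℤ) ^ 2 + 17 * p + 72)),
        4 * (p : ℤ) ^ 2 + 18 * p + 81)))
    {g : ringClassField K ι (9 * p * ℓ) ≃ₐ[ℚ] ringClassField K ι (9 * p * ℓ)}
    (hg : g ∈ ringClassGalOver ι (9 * p * ℓ) (9 * p)) :
    ∃ a₀ : (W.baseChange (ringClassField K ι (9 * p * ℓ))).toAffine.Point,
      ((2 ^ M : ℕ) : ℤ) • a₀ =
        pointGalHom W (ringClassField K ι (9 * p * ℓ)) g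
            (KolyvaginOperator.derivOp (pointGalHom W (ringClassField K ι (9 * p * ℓ))) σ ℓ y) -
          KolyvaginOperator.derivOp (pointGalHom W (ringClassField K ι (9 * p * ℓ))) σ ℓ y := by
  have hp0 : p ≠ 0 := by rintro rfl; simp at hp
  have hℓ3' : ℓ ≠ 3 := by rintro rfl; simp at hℓ3
  have hℓ9 : ¬ ℓ ∣ 9 := by
    intro h
    have h' : ℓ ∣ 3 ^ 2 := by norm_num; exact h
    exact hℓ3' ((Nat.prime_dvd_prime_iff_eq hℓ Nat.prime_three).mp (hℓ.dvd_of_dvd_pow h'))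
  have hℓ9p : ¬ ℓ ∣ 9 * p := by
    intro h
    rcases (Nat.Prime.dvd_mul hℓ).mp h with h9 | hp'
    · exact hℓ9 h9
    · exact hℓp hp'
  -- the cyclic group `H = ⟨σ⟩` acting on `A = E(K[9pℓ])` through `pointGalHom`
  letI : CommGroup (Subgroup.zpowers σ) :=
    { (inferInstance : Group (Subgroup.zpowers σ)) with mul_comm := mul_comm' }
  letI act : DistribMulAction (Subgroup.zpowers σ)
      ((W.baseChange (ringClassField K ι (9 * p * ℓ))).toAffine.Point) :=
    DistribMulAction.compHom _
      ((pointGalHom W (ringClassField K ι (9 * p * ℓ))).comp (Subgroup.zpowers σ).subtype)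
  have hsmul : ∀ (h : Subgroup.zpowers σ) (Q : (W.baseChange (ringClassField K ι (9 * p * ℓ))).toAffine.Point),
      h • Q = pointGalHom W (ringClassField K ι (9 * p * ℓ))
        (h : ringClassField K ι (9 * p * ℓ) ≃ₐ[ℚ] ringClassField K ι (9 * p * ℓ)) Q := fun _ _ ↦ rfl
  have hs_pow : ∀ i : ℕ, (((⟨σ, Subgroup.mem_zpowers σ⟩ : Subgroup.zpowers σ) ^ i : Subgroup.zpowers σ) :
      ringClassField K ι (9 * p * ℓ) ≃ₐ[ℚ] ringClassField K ι (9 * p * ℓ)) = σ ^ i := fun i ↦ by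
    rw [Subgroup.coe_pow]
  -- `D_ℓ y` in the group-ring currency of `KolyvaginEuler`
  have hD : grAct ((W.baseChange (ringClassField K ι (9 * p * ℓ))).toAffine.Point)
        (derivProd (fun _ ↦ (⟨σ, Subgroup.mem_zpowers σ⟩ : Subgroup.zpowers σ)) {ℓ}) y =
      KolyvaginOperator.derivOp (pointGalHom W (ringClassField K ι (9 * p * ℓ))) σ ℓ y := by
    rw [derivProd, Finset.prod_singleton, grAct_derivElt]
    unfold KolyvaginOperator.derivOp
    refine Finset.sum_congr rfl fun i _ ↦ ?_
    rw [hsmul, hs_pow]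
  -- `σ^(ℓ+1) = 1`
  have hordσ : orderOf σ = ℓ + 1 := orderOf_eq_succ_sylvester_prime hK ι hp0 hℓ hℓ9p hinert hσ
  have hord : ∀ q ∈ ({ℓ} : Finset ℕ),
      (fun _ ↦ (⟨σ, Subgroup.mem_zpowers σ⟩ : Subgroup.zpowers σ)) q ^ (q + 1) = 1 := by
    intro q hq
    rw [Finset.mem_singleton] at hq
    subst hq
    apply Subtype.ext
    rw [Subgroup.coe_pow, Subgroup.coe_one, ← hordσ, pow_orderOf_eq_one]
  have hdvd : ∀ q ∈ ({ℓ} : Finset ℕ), ((2 ^ M : ℕ) : ℤ) ∣ ((q + 1 : ℕ) : ℤ) := by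
    intro q hq
    rw [Finset.mem_singleton] at hq
    subst hq
    exact_mod_cast hMℓ
  -- `Tr_ℓ y = a_ℓ • y₀ ∈ 2^M A` ((ES1) + Gross (3.3))
  have htrace : grAct ((W.baseChange (ringClassField K ι (9 * p * ℓ))).toAffine.Point)
      (traceElt (⟨σ, Subgroup.mem_zpowers σ⟩ : Subgroup.zpowers σ) ℓ) y = W.LFunction ℓ • y₀ := by
    rw [grAct_traceElt]
    have : ∀ i ∈ Finset.range (ℓ + 1),
        (⟨σ, Subgroup.mem_zpowers σ⟩ : Subgroup.zpowers σ) ^ i • y =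
          pointGalHom W (ringClassField K ι (9 * p * ℓ)) (σ ^ i) y := fun i _ ↦ by
      rw [hsmul, hs_pow]
    rw [Finset.sum_congr rfl this]
    exact sum_range_pointGalHom_pow_eq_lFunction_smul_sylvester_prime hK hdK ι Dt hp hℓ hℓ3 hℓp hinert
      hσ hy hy₀
  have htr : ∀ q ∈ ({ℓ} : Finset ℕ),
      grAct ((W.baseChange (ringClassField K ι (9 * p * ℓ))).toAffine.Point)
        (traceElt ((fun _ ↦ (⟨σ, Subgroup.mem_zpowers σ⟩ : Subgroup.zpowers σ)) q) q) y ∈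
        zsmulRange ((W.baseChange (ringClassField K ι (9 * p * ℓ))).toAffine.Point) ((2 ^ M : ℕ) : ℤ) := by
    intro q hq
    rw [Finset.mem_singleton] at hq
    subst hq
    exact grAct_traceElt_mem_of_eq_smul htrace hMa
  -- Prop. 3.6 for the generator, then for the whole of `⟨σ⟩`
  have hgen := smul_grAct_derivProd_sub_mem (y := y) hord hdvd htr (Finset.mem_singleton_self ℓ)
  have hgz : g ∈ Subgroup.zpowers σ := by rw [hσ]; exact hg
  have hgH : (⟨g, hgz⟩ : Subgroup.zpowers σ) ∈
      Subgroup.closure ({(⟨σ, Subgroup.mem_zpowers σ⟩ : Subgroup.zpowers σ)} : Set (Subgroup.zpowers σ)) := by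
    rw [← Subgroup.zpowers_eq_closure]
    obtain ⟨k, hk⟩ := Subgroup.mem_zpowers_iff.mp hgz
    exact Subgroup.mem_zpowers_iff.mpr ⟨k, Subtype.ext (by rw [Subgroup.coe_zpow]; exact hk)⟩
  have hall := smul_sub_mem_of_mem_closure
    (B := zsmulRange ((W.baseChange (ringClassField K ι (9 * p * ℓ))).toAffine.Point) ((2 ^ M : ℕ) : ℤ))
    (fun h b hb ↦ smul_mem_zsmulRange h hb)
    (fun s' hs' ↦ by rw [Set.mem_singleton_iff.mp hs']; exact hgen) hgH
  obtain ⟨a₀, ha₀⟩ := (mem_zsmulRange_iff).mp hall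
  refine ⟨a₀, ?_⟩
  rw [ha₀, hsmul, hD]

/-- **The `hfin` shape: for every `τ ∈ Aut(K[9pℓ]/K)` fixing `K[9pℓ] ∩ K[9p]` pointwise,
`∃ a₀ ∈ E(K[9pℓ]), 2^M • a₀ = τ(D_ℓ y_ℓ) − D_ℓ y_ℓ`** — VERBATIM the hypothesis `hfin` of
`exists_fixedPoints_zsmul_eq_of_finite_level` (with `L = K[9pℓ]`, `S = {x | (x : ℂ) ∈ K[9p]}`,
`P₀ = D_ℓ y_ℓ`, `m = 2^M`), whence R0's `hP` at `K̄` for `N' = Gal(K̄/K[9p])`.  The `K`-automorphism `τ`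
restricts to an element of `G_ℓ = ringClassGalOver ι (9pℓ) (9p) = ⟨σ_ℓ⟩`.
[cite: GrossLMS1991, §3 Prop. 3.6, §4 (4.1)] [cite: McCallumLMS1991, §4 (4)] -/
theorem exists_zsmul_eq_map_derivOp_sub_of_fix (hK : IsImaginaryQuadratic K)
    (hdK : NumberField.discr K = -3) (ι : K →+* ℂ) {W : WeierstrassCurve ℚ}
    (Dt : ModularParametrizationData W 243) {p ℓ : ℕ} (hp : p % 3 = 1) (hℓ : ℓ.Prime)
    (hℓ3 : ℓ % 3 = 2) (hℓp : ¬ ℓ ∣ p) (hinert : (Ideal.span {(ℓ : 𝓞 K)}).IsPrime) {M : ℕ}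
    (hMℓ : 2 ^ M ∣ ℓ + 1) (hMa : ((2 ^ M : ℕ) : ℤ) ∣ W.LFunction ℓ)
    {σ : ringClassField K ι (9 * p * ℓ) ≃ₐ[ℚ] ringClassField K ι (9 * p * ℓ)}
    (hσ : Subgroup.zpowers σ = ringClassGalOver ι (9 * p * ℓ) (9 * p))
    {y y₀ : (W.baseChange (ringClassField K ι (9 * p * ℓ))).toAffine.Point}
    (hy : Affine.Point.map (W' := W) (ringClassField K ι (9 * p * ℓ)).subtype.toRatAlgHom y =
      Dt.φ (heegnerTau ((ℓ : ℤ) ^ 2 * (81 * ((p : ℤ) ^ 2 + 4 * p + 16)),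
        (ℓ : ℤ) * (-(9 * (4 * (p : ℤ) ^ 2 + 17 * p + 72))), 4 * (p : ℤ) ^ 2 + 18 * p + 81)))
    (hy₀ : Affine.Point.map (W' := W) (ringClassField K ι (9 * p * ℓ)).subtype.toRatAlgHom y₀ =
      Dt.φ (heegnerTau (81 * ((p : ℤ) ^ 2 + 4 * p + 16), -(9 * (4 * (p : ℤ) ^ 2 + 17 * p + 72)),
        4 * (p : ℤ) ^ 2 + 18 * p + 81))) :
    ∀ τ : ringClassField K ι (9 * p * ℓ) ≃ₐ[K] ringClassField K ι (9 * p * ℓ),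
      (∀ x ∈ {x : ringClassField K ι (9 * p * ℓ) | (x : ℂ) ∈ ringClassField K ι (9 * p)}, τ x = x) →
      ∃ a₀ : (W.baseChange (ringClassField K ι (9 * p * ℓ))).toAffine.Point,
        ((2 ^ M : ℕ) : ℤ) • a₀ =
          Affine.Point.map (W' := W)
              (τ : ringClassField K ι (9 * p * ℓ) →+* ringClassField K ι (9 * p * ℓ)).toRatAlgHom
              (KolyvaginOperator.derivOp (pointGalHom W (ringClassField K ι (9 * p * ℓ))) σ ℓ y) -
            KolyvaginOperator.derivOp (pointGalHom W (ringClassField K ι (9 * p * ℓ))) σ ℓ y := by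
  intro τ hτ
  set g : ringClassField K ι (9 * p * ℓ) ≃ₐ[ℚ] ringClassField K ι (9 * p * ℓ) :=
    τ.restrictScalars ℚ with hg_def
  have hg : g ∈ ringClassGalOver ι (9 * p * ℓ) (9 * p) := by
    rw [ringClassGalOver, mem_fixingSubgroup_iff]
    intro x hx
    exact hτ x hx
  obtain ⟨a₀, ha₀⟩ := exists_zsmul_eq_pointGalHom_derivOp_sub hK hdK ι Dt hp hℓ hℓ3 hℓp hinert hMℓ
    hMa hσ hy hy₀ hg
  refine ⟨a₀, ?_⟩
  rw [ha₀, pointGalHom_apply]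
  rfl

/-- **With `2^M ∣ a_ℓ` DISCHARGED for a minimal `j = 0` model** (every global minimal model `W` of
`E_9`, e.g. `⟨0,0,1,0,−1⟩` with `Δ_min = −243`, k-ty1 #16 `HuShuYin2019/SylvesterNineMinimalModel`):
for a Kolyvagin prime `ℓ ≡ 2 (mod 3)`, `ℓ ≠ 2`, `ℓ ∤ Δ_min(W)`, `a_ℓ = 0` (Deuring, the tree's
`JZero.lFunction_eq_zero_of_j_eq_zero_of_mod_three_eq_two`), so only `2^M ∣ ℓ + 1` remains.
[cite: GrossLMS1991, §3 (3.3), Prop. 3.6] [cite: IrelandRosen1990, Ch. 18 §3] -/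
theorem exists_zsmul_eq_map_derivOp_sub_of_fix_of_j_eq_zero (hK : IsImaginaryQuadratic K)
    (hdK : NumberField.discr K = -3) (ι : K →+* ℂ) {W : WeierstrassCurve ℚ} [W.IsElliptic]
    [W.IsGloballyMinimal] (hj : W.j = 0) (Dt : ModularParametrizationData W 243) {p ℓ : ℕ}
    (hp : p % 3 = 1) (hℓ : ℓ.Prime) (hℓ3 : ℓ % 3 = 2) (hℓ2 : ℓ ≠ 2) (hℓp : ¬ ℓ ∣ p)
    (hℓΔ : ¬ (ℓ : ℤ) ∣ minimalDiscriminantInt W) (hinert : (Ideal.span {(ℓ : 𝓞 K)}).IsPrime) {M : ℕ}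
    (hMℓ : 2 ^ M ∣ ℓ + 1)
    {σ : ringClassField K ι (9 * p * ℓ) ≃ₐ[ℚ] ringClassField K ι (9 * p * ℓ)}
    (hσ : Subgroup.zpowers σ = ringClassGalOver ι (9 * p * ℓ) (9 * p))
    {y y₀ : (W.baseChange (ringClassField K ι (9 * p * ℓ))).toAffine.Point}
    (hy : Affine.Point.map (W' := W) (ringClassField K ι (9 * p * ℓ)).subtype.toRatAlgHom y =
      Dt.φ (heegnerTau ((ℓ : ℤ) ^ 2 * (81 * ((p : ℤ) ^ 2 + 4 * p + 16)),
        (ℓ : ℤ) * (-(9 * (4 * (p : ℤ) ^ 2 + 17 * p + 72))), 4 * (p : ℤ) ^ 2 + 18 * p + 81)))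
    (hy₀ : Affine.Point.map (W' := W) (ringClassField K ι (9 * p * ℓ)).subtype.toRatAlgHom y₀ =
      Dt.φ (heegnerTau (81 * ((p : ℤ) ^ 2 + 4 * p + 16), -(9 * (4 * (p : ℤ) ^ 2 + 17 * p + 72)),
        4 * (p : ℤ) ^ 2 + 18 * p + 81))) :
    ∀ τ : ringClassField K ι (9 * p * ℓ) ≃ₐ[K] ringClassField K ι (9 * p * ℓ),
      (∀ x ∈ {x : ringClassField K ι (9 * p * ℓ) | (x : ℂ) ∈ ringClassField K ι (9 * p)}, τ x = x) →
      ∃ a₀ : (W.baseChange (ringClassField K ι (9 * p * ℓ))).toAffine.Point,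
        ((2 ^ M : ℕ) : ℤ) • a₀ =
          Affine.Point.map (W' := W)
              (τ : ringClassField K ι (9 * p * ℓ) →+* ringClassField K ι (9 * p * ℓ)).toRatAlgHom
              (KolyvaginOperator.derivOp (pointGalHom W (ringClassField K ι (9 * p * ℓ))) σ ℓ y) -
            KolyvaginOperator.derivOp (pointGalHom W (ringClassField K ι (9 * p * ℓ))) σ ℓ y :=
  exists_zsmul_eq_map_derivOp_sub_of_fix hK hdK ι Dt hp hℓ hℓ3 hℓp hinert hMℓ
    (by rw [JZero.lFunction_eq_zero_of_j_eq_zero_of_mod_three_eq_two W hj hℓ hℓ3 hℓ2 hℓΔ]; exact dvd_zero _)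
    hσ hy hy₀

end Summit.BirchSwinnertonDyer.BirchSwinnertonDyer.Theorems.SylvesterTwoCMData

end
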